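import Mathlib.Topology.Sheaves.Flasque
import Mathlib.Topology.Sheaves.Functors
import Mathlib.Topology.Sheaves.Abelian
import Mathlib.CategoryTheory.Sites.SheafCohomology.Basic
import Mathlib.CategoryTheory.Abelian.GrothendieckCategory.HasExt
import Mathlib.Algebra.Homology.DerivedCategory.Ext.ExactSequences
import Mathlib.Algebra.Homology.ShortComplex.ExactFunctor
import Mathlib.GroupTheory.QuotientGroup.Basic
import Literature.AlgebraicGeometry.Motives.GrothendieckVanishing
import Literature.AlgebraicGeometry.Motives.FlasqueCohomology
import HarnessLib

/-!
# Cohomology of a direct image under a closed immersion (Hartshorne III.2.10): proof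

Topic: `Literature/AlgebraicGeometry/Motives` (discharges the named fact
`Literature.AlgebraicGeometry.Motives.H_pushforward_of_isClosedEmbedding` of `GrothendieckVanishing.lean`).

**Lemma III.2.10** (Hartshorne, *Algebraic Geometry*, p. 209). Let `Y` be a closed subset of `X`,
`ℱ` a sheaf of abelian groups on `Y`, and `j : Y → X` the inclusion. Then
`Hⁱ(Y, ℱ) = Hⁱ(X, j_*ℱ)` for all `i`.

Setting: `X Y : TopCat.{u}`, `j : Y ⟶ X` a closed embedding (`Topology.IsClosedEmbedding j`), abelian
sheaves `Sheaf (Opens.grothendieckTopology _) AddCommGrpCat.{u}` (definitionally Mathlib's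
`TopCat.Sheaf AddCommGrpCat _`), `j_*` = Mathlib's `TopCat.Sheaf.pushforward AddCommGrpCat j`, which is
by definition `(Opens.map j).sheafPushforwardContinuous AddCommGrpCat _ _` (the form used in the
intermediate statements, as a functor between the `Sheaf` categories), and
`Hⁱ(X, ℱ) = Sheaf.H ℱ i = Extⁱ(ℤ_X, ℱ)`.

## The printed proof and the present formalization

Hartshorne: a flasque resolution `𝒥` of `ℱ` on `Y` pushes forward to a flasque resolution `j_*𝒥` of
`j_*ℱ` (`j_*` of a flasque sheaf is flasque, II Ex. 1.16(d); `j_*` is exact for a closed subspace, the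
stalks of `j_*ℱ` being `ℱ_P` for `P ∈ Y` and `0` otherwise, II Ex. 1.19(a)), `Γ(Y, 𝒥ⁱ) = Γ(X, j_*𝒥ⁱ)`,
and cohomology may be computed by flasque resolutions (III.2.5.1, from III.2.5 and III.1.2A).

Mathlib's `Sheaf.H` is an `Ext`-group and Mathlib does not (yet) compute `Ext` by acyclic
resolutions, so III.1.2A is unrolled here into the equivalent dimension-shifting induction, with the
same ingredients:

* `epi_pushforward_map_of_isClosedEmbedding`, `shortExact_map_pushforward_of_isClosedEmbedding`:
  `j_*` is exact for a closed embedding `j` (left exact as a right adjoint, Mathlib's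
  `Functor.sheafAdjunctionContinuous`, the `Sheaf`-level form of
  `TopCat.Sheaf.pullbackPushforwardAdjunction`; it preserves epimorphisms by local surjectivity: a
  section of `j_*𝒢` over `U` lifts locally on `U ∩ Y` because `Y` carries the subspace topology, and
  is zero on `U ∖ Y`, which is open since `Y` is closed);
* Mathlib's `TopCat.Sheaf.IsFlasque.pushforward_isFlasque` (II Ex. 1.16(d)) and
  `isFlasque_of_injective`, `subsingleton_H_succ_of_isFlasque` (III.2.4, III.2.5, `FlasqueCohomology.lean`);
* `Γ(X, j_*ℱ) = Γ(Y, ℱ)` (definitional) and `H⁰ = Γ` (Mathlib's `Sheaf.H.equiv₀`).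

Induction (`nonempty_addEquiv_H_pushforward`): embed `ℱ ↪ ℐ` with `ℐ` injective, `𝒢 = ℐ/ℱ`; then
`0 → j_*ℱ → j_*ℐ → j_*𝒢 → 0` is exact with `j_*ℐ` flasque. Degree `0`: both sides are `Γ(Y, ℱ)`.
Degree `1`: `H¹(Y, ℱ)` and `H¹(X, j_*ℱ)` are both the quotient of `Γ(Y, 𝒢) = Γ(X, j_*𝒢)` by the image of
`Γ(Y, ℐ) = Γ(X, j_*ℐ)` (`exists_connectingHom_H_one`). Degree `n + 2`: `Hⁿ⁺²(Y, ℱ) ≅ Hⁿ⁺¹(Y, 𝒢)` and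
`Hⁿ⁺²(X, j_*ℱ) ≅ Hⁿ⁺¹(X, j_*𝒢)` (`Ext.postcomp_extClass_bijective`), and induction applied to `𝒢`.
The isomorphisms are obtained as abstract isomorphisms of abelian groups (which is what the named
fact asserts); their naturality is not recorded.

## References

* R. Hartshorne, *Algebraic Geometry*, GTM 52, Springer (1977), doi:10.1007/978-1-4757-3849-0,
  III.2, Lemma 2.10 (p. 209) with II Ex. 1.16(d), 1.19(a) and III.2.4, 2.5. [Hartshorne1977]
-/

open CategoryTheory Limits Opposite TopologicalSpace Abelian

universe w v' u' u

namespace Literature.AlgebraicGeometry.Motives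

/-! ### Two surjections with the same kernel -/

section Algebra

/-- Two surjective additive homomorphisms out of the same abelian group with the same kernel have
isomorphic targets (both are the quotient by that kernel). [folklore] -/
theorem nonempty_addEquiv_of_surjective_of_ker_eq {A B₁ B₂ : Type*} [AddCommGroup A]
    [AddCommGroup B₁] [AddCommGroup B₂] (δ₁ : A →+ B₁) (δ₂ : A →+ B₂)
    (h₁ : Function.Surjective δ₁) (h₂ : Function.Surjective δ₂) (hker : δ₁.ker = δ₂.ker) :
    Nonempty (B₁ ≃+ B₂) :=
  ⟨(QuotientAddGroup.quotientKerEquivOfSurjective δ₁ h₁).symm.trans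
    ((QuotientAddGroup.quotientAddEquivOfEq hker).trans
      (QuotientAddGroup.quotientKerEquivOfSurjective δ₂ h₂))⟩

end Algebra

/-! ### The connecting homomorphism flanked by zeros -/

section ExtSequence

variable {C : Type u'} [Category.{v'} C] [Abelian C] [HasExt.{w} C] (A : C) {S : ShortComplex C}
  (hS : S.ShortExact)

include hS in
/-- For a short exact `0 → X₁ → X₂ → X₃ → 0` and an object `A` with `Extⁿ⁺¹(A, X₂) = 0` and
`Extⁿ⁺²(A, X₂) = 0`, the connecting homomorphism `Extⁿ⁺¹(A, X₃) → Extⁿ⁺²(A, X₁)` is bijective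
(exactness of `Extⁿ⁺¹(A, X₂) → Extⁿ⁺¹(A, X₃) → Extⁿ⁺²(A, X₁) → Extⁿ⁺²(A, X₂)`; the step
"`Hⁱ(X, ℱ) ≅ Hⁱ⁻¹(X, 𝒢)` for `i ≥ 2`" of Hartshorne III.2.5 and III.2.10). [folklore] -/
theorem Ext.postcomp_extClass_bijective (n : ℕ) [Subsingleton (Ext A S.X₂ (n + 1))]
    [Subsingleton (Ext A S.X₂ (n + 2))] :
    Function.Bijective (hS.extClass.postcomp A (rfl : (n + 1) + 1 = n + 2)) := by
  constructor
  · rw [injective_iff_map_eq_zero]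
    intro x hx
    obtain ⟨x₂, rfl⟩ := Ext.covariant_sequence_exact₃ A hS x rfl hx
    rw [Subsingleton.elim x₂ 0, Ext.zero_comp]
  · intro x₁
    exact Ext.covariant_sequence_exact₁ A hS x₁ (Subsingleton.elim _ _) rfl

end ExtSequence

/-! ### `H¹` as a quotient of global sections -/

section HOne

variable {X : TopCat.{u}} {S : ShortComplex (Sheaf (Opens.grothendieckTopology X) AddCommGrpCat.{u})}

/-- For a short exact sequence `0 → ℱ → 𝒢 → ℋ → 0` of abelian sheaves on a space `X` with
`H¹(X, 𝒢) = 0`, the connecting homomorphism `δ : Γ(X, ℋ) → H¹(X, ℱ)` (transported along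
`H⁰(X, ℋ) ≃ Γ(X, ℋ)`) is surjective with kernel the image of `Γ(X, 𝒢) → Γ(X, ℋ)`, i.e.
`H¹(X, ℱ) ≅ Γ(X, ℋ) / im Γ(X, 𝒢)` (exactness of `H⁰(X, 𝒢) → H⁰(X, ℋ) → H¹(X, ℱ) → H¹(X, 𝒢) = 0`).
[folklore] -/
theorem exists_connectingHom_H_one (hS : S.ShortExact) [Subsingleton (S.X₂.H 1)] :
    ∃ δ : (S.X₃.obj.obj (op ⊤) : Type u) →+ S.X₁.H 1,
      Function.Surjective δ ∧ δ.ker = (S.g.hom.app (op ⊤)).hom.range := by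
  refine ⟨AddMonoidHom.mk'
    (fun s => ((Sheaf.H.equiv₀ S.X₃ isTerminalTop).symm s).comp hS.extClass (zero_add 1))
    (fun a b => by rw [map_add, Ext.add_comp]), ?_, ?_⟩
  · intro x₁
    obtain ⟨x₃, hx₃⟩ :=
      Ext.covariant_sequence_exact₁ _ hS x₁ (Subsingleton.elim _ _) (zero_add 1)
    refine ⟨Sheaf.H.equiv₀ S.X₃ isTerminalTop x₃, ?_⟩
    rw [AddMonoidHom.mk'_apply, AddEquiv.symm_apply_apply, hx₃]
  · ext s
    rw [AddMonoidHom.mem_ker, AddMonoidHom.mk'_apply, AddMonoidHom.mem_range]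
    constructor
    · intro h
      obtain ⟨x₂, hx₂⟩ := Ext.covariant_sequence_exact₃ _ hS _ (zero_add 1) h
      refine ⟨Sheaf.H.equiv₀ S.X₂ isTerminalTop x₂, ?_⟩
      change S.g.hom.app (op ⊤) (Sheaf.H.equiv₀ S.X₂ isTerminalTop x₂) = s
      rw [Sheaf.H.equiv₀_naturality, Sheaf.H.map_apply, hx₂, AddEquiv.apply_symm_apply]
    · rintro ⟨t, rfl⟩
      change ((Sheaf.H.equiv₀ S.X₃ isTerminalTop).symm (S.g.hom.app (op ⊤) t)).comp
        hS.extClass (zero_add 1) = 0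
      rw [← Sheaf.H.equiv₀_symm_naturality, Sheaf.H.map_apply,
        Ext.comp_assoc_of_second_deg_zero, hS.comp_extClass, Ext.comp_zero]

end HOne

/-! ### Direct image under a closed embedding is exact -/

section ClosedEmbedding

variable {X Y : TopCat.{u}} {j : Y ⟶ X}

/-! Below, Mathlib's direct image functor `j_*` on sheaves of abelian groups along `j : Y ⟶ X` is
written `(Opens.map j).sheafPushforwardContinuous AddCommGrpCat _ _`, i.e. as a functor
`Sheaf (Opens.grothendieckTopology Y) AddCommGrpCat ⥤ Sheaf (Opens.grothendieckTopology X) AddCommGrpCat`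
between the categories in which Mathlib's sheaf cohomology `Sheaf.H` lives; this is
`TopCat.Sheaf.pushforward AddCommGrpCat j` by definition. -/

/-- For a closed embedding `j : Y ⟶ X`, the direct image functor `j_*` on sheaves of abelian groups
preserves epimorphisms. Proof: epimorphisms of sheaves are the locally surjective maps; given
`φ : ℱ ⟶ 𝒢` locally surjective on `Y`, an open `U ⊆ X`, a section `t ∈ 𝒢(j⁻¹U)` and `x ∈ U`:
if `x ∉ Y`, then `t` restricts to `𝒢(∅) = 0` over the open neighbourhood `U ∖ Y` of `x`; if
`x = j(y)`, a local lift of `t` near `y` lives on an open of `Y`, which is `j⁻¹W` for an open `W` of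
`X` since `j` is an embedding. (Hartshorne II, Ex. 1.19(a) computes the stalks of `j_*ℱ`, from which
this is usually deduced.) [folklore] -/
theorem epi_pushforward_map_of_isClosedEmbedding (hj : Topology.IsClosedEmbedding j)
    {F G : Sheaf (Opens.grothendieckTopology Y) AddCommGrpCat.{u}} (φ : F ⟶ G) [Epi φ] :
    Epi (((Opens.map j).sheafPushforwardContinuous AddCommGrpCat.{u}
      (Opens.grothendieckTopology X) (Opens.grothendieckTopology Y)).map φ) := by
  refine (TopCat.Sheaf.isLocallySurjective_iff_epi _).mp ?_
  rw [TopCat.Presheaf.isLocallySurjective_iff]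
  have hφ := (TopCat.Presheaf.isLocallySurjective_iff φ.hom).mp
    ((TopCat.Sheaf.isLocallySurjective_iff_epi φ).mpr ‹Epi φ›)
  intro U t x hx
  by_cases hxY : x ∈ Set.range j
  · obtain ⟨y, rfl⟩ := hxY
    obtain ⟨V', hV'U, ⟨s', hs'⟩, hyV'⟩ := hφ ((Opens.map j).obj U) t y hx
    obtain ⟨W, rfl⟩ : ∃ W : Opens X, (Opens.map j).obj W = V' := by
      obtain ⟨W, hW, hWV'⟩ := hj.isOpen_iff.mp V'.2
      exact ⟨⟨W, hW⟩, Opens.ext hWV'⟩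
    refine ⟨U ⊓ W, inf_le_left,
      ⟨(((Opens.map j).sheafPushforwardContinuous AddCommGrpCat.{u} (Opens.grothendieckTopology X)
        (Opens.grothendieckTopology Y)).obj F).obj.map (homOfLE inf_le_right).op s', ?_⟩,
      Opens.mem_inf.mpr ⟨hx, hyV'⟩⟩
    rw [← CategoryTheory.comp_apply, NatTrans.naturality, CategoryTheory.comp_apply]
    change G.obj.map _ (φ.hom.app (op ((Opens.map j).obj W)) s') = G.obj.map _ t
    rw [hs', TopCat.Presheaf.restrictOpen, TopCat.Presheaf.restrict, ← CategoryTheory.comp_apply,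
      ← Functor.map_comp]
    rfl
  · refine ⟨U ⊓ ⟨(Set.range j)ᶜ, hj.isClosed_range.isOpen_compl⟩, inf_le_left, ⟨0, ?_⟩,
      Opens.mem_inf.mpr ⟨hx, hxY⟩⟩
    rw [map_zero]
    exact TopCat.Presheaf.IsSheaf.section_ext G.2 fun y hy => absurd (Set.mem_range_self y) hy.2

/-- For a closed embedding `j : Y ⟶ X`, the direct image functor `j_*` on sheaves of abelian groups
is exact: it carries short exact sequences to short exact sequences (left exact as a right adjoint,
Mathlib's `Functor.sheafAdjunctionContinuous` / `TopCat.Sheaf.pullbackPushforwardAdjunction`, and it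
preserves epimorphisms, `epi_pushforward_map_of_isClosedEmbedding`). [folklore] -/
theorem shortExact_map_pushforward_of_isClosedEmbedding (hj : Topology.IsClosedEmbedding j)
    {S : ShortComplex (Sheaf (Opens.grothendieckTopology Y) AddCommGrpCat.{u})}
    (hS : S.ShortExact) :
    (S.map ((Opens.map j).sheafPushforwardContinuous AddCommGrpCat.{u}
      (Opens.grothendieckTopology X) (Opens.grothendieckTopology Y))).ShortExact := by
  have : ((Opens.map j).sheafPushforwardContinuous AddCommGrpCat.{u}
      (Opens.grothendieckTopology X) (Opens.grothendieckTopology Y)).Additive :=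
    Functor.additive_of_preserves_binary_products _
  have := hS.epi_g
  obtain ⟨h₁, h₂⟩ := (Functor.preservesFiniteLimits_iff_forall_exact_map_and_mono
    ((Opens.map j).sheafPushforwardContinuous AddCommGrpCat.{u} (Opens.grothendieckTopology X)
      (Opens.grothendieckTopology Y))).mp inferInstance S hS
  exact ShortComplex.ShortExact.mk' h₁ h₂ (epi_pushforward_map_of_isClosedEmbedding hj S.g)

/-! ### Hartshorne III.2.10 -/

/-- Degree `0` of III.2.10, for any continuous `j : Y ⟶ X`:
`H⁰(Y, ℱ) ≅ Γ(Y, ℱ) = Γ(X, j_*ℱ) ≅ H⁰(X, j_*ℱ)`. [cite: Hartshorne1977, III.2.10] -/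
theorem nonempty_addEquiv_H_zero_pushforward
    (F : Sheaf (Opens.grothendieckTopology Y) AddCommGrpCat.{u}) :
    Nonempty (F.H 0 ≃+ (((Opens.map j).sheafPushforwardContinuous AddCommGrpCat.{u}
      (Opens.grothendieckTopology X) (Opens.grothendieckTopology Y)).obj F).H 0) :=
  ⟨(Sheaf.H.equiv₀ F isTerminalTop).trans (Sheaf.H.equiv₀ (((Opens.map j).sheafPushforwardContinuous
    AddCommGrpCat.{u} (Opens.grothendieckTopology X) (Opens.grothendieckTopology Y)).obj F)
      isTerminalTop).symm⟩

/-- Degree `1` of III.2.10 along a short exact `0 → ℱ → ℐ → 𝒢 → 0` on `Y` with `ℐ` injective: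
`H¹(Y, ℱ)` and `H¹(X, j_*ℱ)` are both the cokernel of `Γ(Y, ℐ) → Γ(Y, 𝒢)`, which is literally the map
`Γ(X, j_*ℐ) → Γ(X, j_*𝒢)` (here `j_*ℐ` is flasque, II Ex. 1.16(d) and III.2.4, so `H¹(X, j_*ℐ) = 0` by
III.2.5). [cite: Hartshorne1977, III.2.10] -/
theorem nonempty_addEquiv_H_one_pushforward (hj : Topology.IsClosedEmbedding j)
    {S : ShortComplex (Sheaf (Opens.grothendieckTopology Y) AddCommGrpCat.{u})}
    (hS : S.ShortExact) [Injective S.X₂] :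
    Nonempty (S.X₁.H 1 ≃+ (((Opens.map j).sheafPushforwardContinuous AddCommGrpCat.{u}
      (Opens.grothendieckTopology X) (Opens.grothendieckTopology Y)).obj S.X₁).H 1) := by
  set S' := S.map ((Opens.map j).sheafPushforwardContinuous AddCommGrpCat.{u}
    (Opens.grothendieckTopology X) (Opens.grothendieckTopology Y))
  have hS' : S'.ShortExact := shortExact_map_pushforward_of_isClosedEmbedding hj hS
  haveI : TopCat.Sheaf.IsFlasque S.X₂ := isFlasque_of_injective S.X₂
  haveI : TopCat.Sheaf.IsFlasque S'.X₂ :=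
    TopCat.Sheaf.IsFlasque.pushforward_isFlasque (C := AddCommGrpCat.{u}) S.X₂ j
  haveI : Subsingleton (S'.X₂.H 1) := subsingleton_H_succ_of_isFlasque S'.X₂ 0
  obtain ⟨δ, hδ, hker⟩ := exists_connectingHom_H_one hS
  obtain ⟨δ', hδ', hker'⟩ := exists_connectingHom_H_one hS'
  exact nonempty_addEquiv_of_surjective_of_ker_eq δ δ' hδ hδ' (hker.trans hker'.symm)

/-- The inductive step of III.2.10 along a short exact `0 → ℱ → ℐ → 𝒢 → 0` on `Y` with `ℐ`
injective: `Hⁿ⁺²(Y, ℱ) ≅ Hⁿ⁺¹(Y, 𝒢)` and `Hⁿ⁺²(X, j_*ℱ) ≅ Hⁿ⁺¹(X, j_*𝒢)` (connecting isomorphisms,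
`j_*ℐ` being flasque hence acyclic, III.2.5), so an isomorphism `Hⁿ⁺¹(Y, 𝒢) ≅ Hⁿ⁺¹(X, j_*𝒢)` yields
`Hⁿ⁺²(Y, ℱ) ≅ Hⁿ⁺²(X, j_*ℱ)`. [cite: Hartshorne1977, III.2.10] -/
theorem nonempty_addEquiv_H_succ_succ_pushforward (hj : Topology.IsClosedEmbedding j)
    {S : ShortComplex (Sheaf (Opens.grothendieckTopology Y) AddCommGrpCat.{u})}
    (hS : S.ShortExact) [Injective S.X₂] (n : ℕ)
    (e : S.X₃.H (n + 1) ≃+ (((Opens.map j).sheafPushforwardContinuous AddCommGrpCat.{u}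
      (Opens.grothendieckTopology X) (Opens.grothendieckTopology Y)).obj S.X₃).H (n + 1)) :
    Nonempty (S.X₁.H (n + 2) ≃+ (((Opens.map j).sheafPushforwardContinuous AddCommGrpCat.{u}
      (Opens.grothendieckTopology X) (Opens.grothendieckTopology Y)).obj S.X₁).H (n + 2)) := by
  set S' := S.map ((Opens.map j).sheafPushforwardContinuous AddCommGrpCat.{u}
    (Opens.grothendieckTopology X) (Opens.grothendieckTopology Y))
  have hS' : S'.ShortExact := shortExact_map_pushforward_of_isClosedEmbedding hj hS
  haveI : TopCat.Sheaf.IsFlasque S.X₂ := isFlasque_of_injective S.X₂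
  haveI : TopCat.Sheaf.IsFlasque S'.X₂ :=
    TopCat.Sheaf.IsFlasque.pushforward_isFlasque (C := AddCommGrpCat.{u}) S.X₂ j
  haveI : Subsingleton (S'.X₂.H (n + 1)) := subsingleton_H_succ_of_isFlasque S'.X₂ n
  haveI : Subsingleton (S'.X₂.H (n + 2)) := subsingleton_H_succ_of_isFlasque S'.X₂ (n + 1)
  exact ⟨(AddEquiv.ofBijective _ (Ext.postcomp_extClass_bijective _ hS n)).symm.trans
    (e.trans (AddEquiv.ofBijective _ (Ext.postcomp_extClass_bijective _ hS' n)))⟩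

/-- **Hartshorne III.2.10** in positive degrees, by induction: for a closed embedding `j : Y ⟶ X`
and every abelian sheaf `ℱ` on `Y`, `Hⁿ⁺¹(Y, ℱ) ≅ Hⁿ⁺¹(X, j_*ℱ)` (embed `ℱ` in an injective and use
`nonempty_addEquiv_H_one_pushforward`, `nonempty_addEquiv_H_succ_succ_pushforward`).
[cite: Hartshorne1977, III.2.10] -/
theorem nonempty_addEquiv_H_succ_pushforward (hj : Topology.IsClosedEmbedding j) (n : ℕ) :
    ∀ F : Sheaf (Opens.grothendieckTopology Y) AddCommGrpCat.{u},
      Nonempty (F.H (n + 1) ≃+ (((Opens.map j).sheafPushforwardContinuous AddCommGrpCat.{u}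
        (Opens.grothendieckTopology X) (Opens.grothendieckTopology Y)).obj F).H (n + 1)) := by
  induction n with
  | zero =>
    intro F
    have hS : (ShortComplex.cokernelSequence (Injective.ι F)).ShortExact :=
      { exact := ShortComplex.cokernelSequence_exact _
        mono_f := Injective.ι_mono F }
    haveI : Injective (ShortComplex.cokernelSequence (Injective.ι F)).X₂ :=
      Injective.injective_under F
    exact nonempty_addEquiv_H_one_pushforward hj hS
  | succ n ih =>
    intro F
    have hS : (ShortComplex.cokernelSequence (Injective.ι F)).ShortExact :=
      { exact := ShortComplex.cokernelSequence_exact _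
        mono_f := Injective.ι_mono F }
    haveI : Injective (ShortComplex.cokernelSequence (Injective.ι F)).X₂ :=
      Injective.injective_under F
    obtain ⟨e⟩ := ih (ShortComplex.cokernelSequence (Injective.ι F)).X₃
    exact nonempty_addEquiv_H_succ_succ_pushforward hj hS n e

/-- **Hartshorne III.2.10**: for a closed embedding `j : Y ⟶ X` of topological spaces and a sheaf of
abelian groups `ℱ` on `Y`, `Hⁱ(Y, ℱ) ≅ Hⁱ(X, j_*ℱ)` for all `i` (as abelian groups; `Hⁱ` is Mathlib's
`Sheaf.H`, `j_*` is Mathlib's `TopCat.Sheaf.pushforward`). [cite: Hartshorne1977, III.2.10] -/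
theorem nonempty_addEquiv_H_pushforward (hj : Topology.IsClosedEmbedding j)
    (F : Sheaf (Opens.grothendieckTopology Y) AddCommGrpCat.{u}) (i : ℕ) :
    Nonempty (F.H i ≃+ ((TopCat.Sheaf.pushforward AddCommGrpCat.{u} j).obj F).H i) := by
  cases i with
  | zero => exact nonempty_addEquiv_H_zero_pushforward F
  | succ n => exact nonempty_addEquiv_H_succ_pushforward hj n F

end ClosedEmbedding

/-- Discharge of the named fact `Literature.AlgebraicGeometry.Motives.H_pushforward_of_isClosedEmbedding`
(**Hartshorne III.2.10**: `Hⁱ(Y, ℱ) ≅ Hⁱ(X, j_*ℱ)` for the inclusion `j` of a closed subset `Y ⊆ X`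
and every sheaf of abelian groups `ℱ` on `Y`). [cite: Hartshorne1977, III.2.10] -/
theorem H_pushforward_of_isClosedEmbedding_holds : H_pushforward_of_isClosedEmbedding.{u} :=
  fun _ _ _ hj F i => nonempty_addEquiv_H_pushforward hj F i

end Literature.AlgebraicGeometry.Motives
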